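import Summits.ABC.IUTFork.LDHSplitLocusDisplayPoint
import Summits.ABC.IUTFork.Conditional.AbcOfSHvolSplitHeight
import Summits.ABC.IUTFork.LDHGenuineTowerArithPinned
import Literature.NumberTheory.DiophantineGeometry.GenEllMellReduction
import Literature.IUT.LogVolume.HeightDivisor
import Literature.IUT.LogVolume.GenuineRamificationBoundsPinned
import HarnessLib

/-!
# The fork at [IUTchIII] Corollary 3.12, L-DH level: on the NON-SPLIT locus the (U)-computable half is a THEOREM —
# the positive complement of the split-bad certificate (`LDHSplitLocusDisplay{,Point}`), at every `d_mod`

Proof-only record file (D-0012; 0 definitions, no `Prop` fact) of the abc-iut cell (R2 S-CHAIN TEAM seat abc-iut-s2-p4,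
TARGET #1 «hvol/hreg residue»; sequel of p434756 / p435674 / p436687). TAKES NO SIDE on [IUTchIII] Cor. 3.12 or on
[IUTchIV] Thm. 1.10. S. Mochizuki, *IUT IV* [Mochizuki2012], Thm. 1.10 proof Step (v) (kurims pp. 27–28: «we may
assume that `i†` is `j`» — harmless exactly when the `(j+1)`-collections of places over one prime carry one `q`-order),
Cor. 2.2 (ii) proof (P5) p. 46; Dupuy–Hilado [DupuyHilado2025] §3.3, §3.6, §4.7; Neukirch, *ANT* Ch. I (8.2).

THE PICTURE AT `d_mod ≥ 2` (all kernel). The registered (U)-stub `stub_hullRegime` of crux `ThetaPartII` (stmt-ABC-19678)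
— = the CONE binder `hreg` of `Conditional.abc_of_S_v4` / `abc_of_SH_v5K` (p431657 / p434856; byte-identical binders) —
demands the hull estimate `T.HullEstimateOf B_III(P,l)` only at NON-slot-constant data. abc-iut-c312-8 proved it VACUOUS
at `d_mod = 1` (`ThetaPartII.hullRegime_vacuous_of_dmod_eq_one`: one place of `F_mod = ℚ` over each prime). THIS FILE
gives the `d_mod`-free form, read ON THE POINT `P = (F_tpd, λ)`: if every rational prime under a pole of `j(λ)` not
dividing `2l` carries EXACTLY ONE place of `F_tpd = ℚ(λ)` («non-split locus»: such primes inert or totally ramified in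
`ℚ(λ)`), then EVERY genuine Θ-volume datum at `(P, l)` is slot-constant — so `hreg`'s instance at `(P, l)` holds with any
conclusion, and v3's `hvol` instance `Cor22.HullVolumeAtDatum P l B_III(P,l)` is a THEOREM there (abc-iut-S3's pinned
junction `hullEstimateOf_BIII_pinned` + abc-iut-S1's (R4) `R4_towerFact`): (ii′-U) CLOSED on the non-split locus.

* `PointDict.under_mem_badPrimesMod_iff` — for a place `y` of the datum's field `F`: `y ∩ 𝓞_{F_mod} ∈ 𝕍^bad_mod ⟺
  y ∩ 𝓞_{F_tpd} ∈ Cor22.badPlacesAvoid P {2,l}` (⟹ p435674; ⟸ semistability of `E_F` ([IUTchI] Def. 3.1 (b)): at a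
  good place `|j|_y ≤ 1` (the tree's `valuation_j_le_one_of_hasGoodReduction_localMinimalModel`), while a pole of `j(λ)`
  below forces `ord_y j(E_F) < 0` by `T.j_eq`; then the (P5) choice `T.isP5Choice`);
* `PointDict.logQloc_eq_pointValue` — the datum's canonical `log(q_v)` at a place `v` of `F_mod` IS the point's
  `(−ord_V j(λ))·log N(V)/n_V` at the place `V` of `ℚ(λ)` under any place of `F` above `v` (and `0` if `V` is no pole
  away from `2l`) — abc-iut-s2-p5's extension-invariance `ord_mul_logNorm_div_localDegree_finBelow_eq` BY NAME;
* **`PointDict.slotConstant_of_nonsplitPoint`** — non-split locus ⟹ every datum at `(P, l)` is slot-constant;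
* **`hullRegimeAt_of_nonsplitPoint`** — hence the registered stub / `hreg` instance at `(P, l)` holds with ANY conclusion;
* **`hullVolumeAtDatum_BIII_of_nonsplitPoint`** (`P ∈ U_P`, `7 ≤ l`) — `Cor22.HullVolumeAtDatum P l B_III(P,l)`, i.e. the
  (U)-computable half with print's `B_III`, for EVERY datum, NO hypothesis beyond the locus; **`hvolAt_of_nonsplitPoint`** —
  the same under the binders of `hvol` (prime `l ≥ 5` with `CondP6` gives `7 ≤ l`, abc-iut-S-d1/L5-t7).

READING (for the C lead / §H / s2 SCOREBOARD; nothing asserted about print). Together with `LDHSplitLocusDisplayPoint`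
(p435674/p436687) the kernel now carries the TRICHOTOMY of the (U)-line at `d_mod ≥ 2`: on the NON-SPLIT locus (ii′-U) is
a THEOREM and the Corollary stub `stub_cor312` carries all the content (exactly as at `d_mod = 1`); on the SPLIT-BAD locus
the Corollary stub is a THEOREM and (ii′-U)/`hreg` carries [IUTchIV] Thm. 1.10's display (Szpiro-type); in between both
carry content (abc-iut-S7/S8/s2-p2/s2-p5/w6-d018 place-by-place bounds, abc-iut-c312-d1/s2-p1 height thresholds). HONEST
SCOPE: consequences of the typed (U)-objects at genuine data ((Ind1) = all capsule-index permutations, R2); no datum is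
constructed; no side taken on Cor. 3.12 / Thm. 1.10 or on any author; typed ≠ proved. PROOF-ONLY file.
[cite: Mochizuki2012, IUTchIV Thm. 1.10 Step (v) p. 27–28] [cite: Mochizuki2012, IUTchIV Cor. 2.2 (ii) proof p. 46]
[cite: Mochizuki2012, IUTchI Def. 3.1 (b) p. 61] [cite: DupuyHilado2025, §3.3, §3.6, §4.7]
[cite: NeukirchANT1999, Ch. I §8 Prop. (8.2)] [claim: Mochizuki2012, status: disputed] for every IUT quotation.
-/

noncomputable section

namespace Summit.ABC.IUTFork

open Literature.IUT.HodgeTheaters Literature.IUT.LogVolume NumberField IsDedekindDomain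
open Literature.NumberTheory.DiophantineGeometry.GenEll
open Summit.ABC.ABC.Theorems

namespace PointDict

variable {P : NFPoint} {l : ℕ}

/-! ## Bad places of the datum's `F_mod` versus poles of `j(λ)` in `F_tpd`, read through a place of `F` -/

/-- **`y ∩ 𝓞_{F_mod} ∈ 𝕍^bad_mod ⟺ y ∩ 𝓞_{F_tpd}` is a pole of `j(λ)` away from `2l`**, for a genuine Θ-volume datum `T`
at `(P, l)` and a finite place `y` of its field `F`. (⟹): p435674 `finBelow_mem_badPlacesAvoid_of_mem_VFbad` with
abc-iut-S2's `ThetaData.mk_mem_VFbad_iff`. (⟸): a pole of `j(λ)` below gives `ord_y j(E_F) < 0` (`T.j_eq`, the sign of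
`ord` descends), so `E_F` — semistable, [IUTchI] Def. 3.1 (b) — is not good at `y` (`|j(E_F)|_y ≤ 1` at good places)
hence multiplicative; with `y ∤ 2, l` the (P5) choice `T.isP5Choice` puts `y` in `𝕍(F)^bad`.
[cite: Mochizuki2012, IUTchI Def. 3.1 (b) p. 61] [cite: Mochizuki2012, IUTchIV Cor. 2.2 (ii) proof (P5) p. 46] -/
theorem under_mem_badPrimesMod_iff (T : Cor22.ThetaVolumeDatumAt P l) :
    letI := T.instFieldF; letI := T.instNumberFieldF; letI := T.instAlgebraF; letI := T.instFieldK
    letI := T.instNumberFieldK; letI := T.instAlgebraK; letI := T.instFieldFbar; letI := T.instAlgebraFbar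
    letI := T.instAlgebraKFbar; letI := T.instIsElliptic
    ∀ y : HeightOneSpectrum (𝓞 T.F),
      y.under (𝓞 (fieldOfModuli T.E)) ∈ ThetaData.badPrimesMod T.D ↔
        finBelow P.F T.F y ∈ Cor22.badPlacesAvoid P {2, l} := by
  classical
  letI := T.instFieldF; letI := T.instNumberFieldF; letI := T.instAlgebraF; letI := T.instFieldK
  letI := T.instNumberFieldK; letI := T.instAlgebraK; letI := T.instFieldFbar; letI := T.instAlgebraFbar
  letI := T.instAlgebraKFbar; letI := T.instIsElliptic
  intro y
  constructor
  · intro hy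
    exact finBelow_mem_badPlacesAvoid_of_mem_VFbad T y ((ThetaData.mk_mem_VFbad_iff T.D y).mpr hy)
  · intro hV
    unfold Cor22.badPlacesAvoid at hV
    rw [Finset.mem_filter] at hV
    obtain ⟨hbad, havoid⟩ := hV
    -- `j(λ) ≠ 0` (it has a pole), hence `j(E_F) ≠ 0`
    have hval : 1 < (finBelow P.F T.F y).valuation P.F (Cor22.jInv P.x) := by
      rw [Cor22.badPlaces, Set.Finite.mem_toFinset] at hbad
      exact hbad
    have hj0 : Cor22.jInv P.x ≠ 0 := by
      intro h0
      rw [h0, map_zero] at hval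
      exact not_lt.mpr zero_le_one hval
    have hEj0 : T.E.j ≠ 0 := by
      rw [T.j_eq]
      exact (map_ne_zero (algebraMap P.F T.F)).mpr hj0
    -- `ord_y j(E_F) < 0`
    have hordV : ord P.F (finBelow P.F T.F y) (Cor22.jInv P.x) < 0 := (Cor22.mem_badPlaces_iff_ord_neg P _).mp hbad
    have hordy : ord T.F y T.E.j < 0 := by
      rw [T.j_eq]
      exact (Cor22.ord_algebraMap_neg_iff y (Cor22.jInv P.x)).mpr hordV
    -- multiplicative reduction at `y` (semistable; good would give `|j|_y ≤ 1`)
    have hmult : T.E.HasMultiplicativeReductionAt y := by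
      rcases T.D.isSemistable y with hgood | hmult
      · exfalso
        have hle : y.valuation T.F T.E.j ≤ 1 := valuation_j_le_one_of_hasGoodReduction_localMinimalModel y T.E hgood
        exact absurd ((ord_neg_iff_one_lt_valuation T.F y hEj0).mp hordy) (not_lt.mpr hle)
      · exact hmult
    -- the (P5) choice
    have hP5 := T.isP5Choice (FinitePlace.mk y)
    rw [FinitePlace.maximalIdeal_mk] at hP5
    have hVF : FinitePlace.mk y ∈ T.D.VFbad :=
      hP5.mpr ⟨fun q hq hmem => havoid q hq ((Cor22.natCast_mem_asIdeal_finBelow_iff (F := P.F) y q).mpr hmem), hmult⟩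
    exact (ThetaData.mk_mem_VFbad_iff T.D y).mp hVF

/-! ## The datum's canonical `log(q_v)` is the point's local height below -/

open scoped Classical in
/-- **The canonical `log(q_v)` of the datum IS the point's normalised local height of `j(λ)`.** For a genuine Θ-volume
datum `T` at `(P, l)`, a support prime `p`, a place `v` of `F_mod` over `p` and ANY place `y` of `F` above `v`:
`log(q_v) = (−ord_V j(λ))·log N(V)/n_V` if the place `V := y ∩ 𝓞_{F_tpd}` of `ℚ(λ)` is a pole of `j(λ)` away from `2l`,
and `0` otherwise (`log(q_v) = ord_v(q_v)·log N(v)/n_v` on `𝕍^bad_mod`, `ord_v(q_v) = −ord_v(j(E_F))`, Dupuy–Hilado §3.3;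
the normalised local height does not see the field — abc-iut-s2-p5 `ord_mul_logNorm_div_localDegree_finBelow_eq`, applied
to `j(E_F) ∈ F_mod` and `j(λ) ∈ F_tpd`, which have the same image `j(E_F)` in `F` by `T.j_eq`).
[cite: DupuyHilado2025, §3.3, §3.6] [cite: NeukirchANT1999, Ch. I §8 Prop. (8.2)] -/
theorem logQloc_eq_pointValue (T : Cor22.ThetaVolumeDatumAt P l) :
    letI := T.instFieldF; letI := T.instNumberFieldF; letI := T.instAlgebraF; letI := T.instFieldK
    letI := T.instNumberFieldK; letI := T.instAlgebraK; letI := T.instFieldFbar; letI := T.instAlgebraFbar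
    letI := T.instAlgebraKFbar; letI := T.instIsElliptic
    ∀ (p : ℕ) (v : placesOver (fieldOfModuli T.E) p) (y : HeightOneSpectrum (𝓞 T.F)),
      y.under (𝓞 (fieldOfModuli T.E)) = v.1 →
      (Summit.ABC.IUTFork.DHData.ofInput T.I).logQloc p v =
        if finBelow P.F T.F y ∈ Cor22.badPlacesAvoid P {2, l} then
          -((ord P.F (finBelow P.F T.F y) (Cor22.jInv P.x) : ℝ) * logNorm P.F (finBelow P.F T.F y) /
            (localDegree P.F (finBelow P.F T.F y) : ℝ))
        else 0 := by
  letI := T.instFieldF; letI := T.instNumberFieldF; letI := T.instAlgebraF; letI := T.instFieldK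
  letI := T.instNumberFieldK; letI := T.instAlgebraK; letI := T.instFieldFbar; letI := T.instAlgebraFbar
  letI := T.instAlgebraKFbar; letI := T.instIsElliptic
  intro p v y hy
  obtain ⟨hS, hj, -⟩ := X_S_eq T
  have hfin : finBelow (fieldOfModuli T.E) T.F y = v.1 :=
    HeightOneSpectrum.ext (by rw [← hy, HeightOneSpectrum.under_asIdeal]; rfl)
  -- same image of `j(E_F) ∈ F_mod` and `j(λ) ∈ F_tpd` in `F`
  have hab : algebraMap (fieldOfModuli T.E) T.F (ThetaData.jMod T.E) = algebraMap P.F T.F (Cor22.jInv P.x) := by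
    rw [ThetaData.algebraMap_jMod]; exact T.j_eq
  have hinv := ord_mul_logNorm_div_localDegree_finBelow_eq (A := fieldOfModuli T.E) (B := P.F) (K := T.F) hab y
  rw [hfin] at hinv
  rw [DHData.logQloc, DHData.ofInput_X]
  by_cases hv : v.1 ∈ T.I.X.S
  · -- bad place: `log(q_v) = (−ord_v j(E_F))·log N(v)/n_v`, and `V` is a pole away from `2l`
    have hV : finBelow P.F T.F y ∈ Cor22.badPlacesAvoid P {2, l} := by
      rw [← under_mem_badPrimesMod_iff T y, hy, ← hS]; exact hv
    rw [if_pos hV]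
    have hq : T.I.X.qDivisor v.1 = (T.I.X.ordq v.1 : ℝ) := by
      classical
      simp only [PilotData.qDivisor, FinDivisor.of, Finsupp.finsetSum_apply, Finsupp.single_apply, Finset.sum_ite_eq',
        if_pos hv]
    rw [hq, PilotData.ordq, hj]
    push_cast
    rw [neg_mul, neg_div, hinv]
  · -- not a bad place: both sides vanish
    have hV : finBelow P.F T.F y ∉ Cor22.badPlacesAvoid P {2, l} := by
      rw [← under_mem_badPrimesMod_iff T y, hy, ← hS]; exact hv
    rw [if_neg hV]
    have hq : T.I.X.qDivisor v.1 = 0 := by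
      classical
      simp only [PilotData.qDivisor, FinDivisor.of, Finsupp.finsetSum_apply, Finsupp.single_apply, Finset.sum_ite_eq',
        if_neg hv]
    rw [hq, zero_mul, zero_div]

/-! ## The non-split locus is slot-constant -/

/-- **On the non-split locus every datum is slot-constant.** If every rational prime lying under a pole of `j(λ)` in
`F_tpd = ℚ(λ)` not dividing `2l` carries exactly one place of `F_tpd` (`#V(F_tpd)_p ≤ 1`; such primes are inert or totally
ramified in `ℚ(λ)`), then for every genuine Θ-volume datum `T` at `(P, l)` the canonical `log(q_v)` takes one value on the
places of `F_mod` over each support prime: two places `v, w` of `F_mod` over `p` are read through places `x, y` of `F`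
above them (going up, abc-iut-S2's `PlaceSection.exists_under_eq`), whose places `x ∩ 𝓞_{F_tpd}`, `y ∩ 𝓞_{F_tpd}` of `ℚ(λ)`
over `p` coincide as soon as one of them is a pole away from `2l` (`logQloc_eq_pointValue`). At `d_mod = 1` this is
abc-iut-c312-8's `hullRegime_vacuous_of_dmod_eq_one` / abc-iut-S3's `slotConstant_of_dmod_eq_one`.
[cite: Mochizuki2012, IUTchIV Thm. 1.10 Step (v) p. 27–28] [cite: DupuyHilado2025, §3.6, §4.7] -/
theorem slotConstant_of_nonsplitPoint (T : Cor22.ThetaVolumeDatumAt P l)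
    (hns : ∀ (p : ℕ) [Fact p.Prime], (∃ V ∈ placesOver P.F p, V ∈ Cor22.badPlacesAvoid P {2, l}) →
      (placesOver P.F p).card ≤ 1) :
    letI := T.instFieldF; letI := T.instNumberFieldF; letI := T.instAlgebraF; letI := T.instFieldK
    letI := T.instNumberFieldK; letI := T.instAlgebraK; letI := T.instFieldFbar; letI := T.instAlgebraFbar
    letI := T.instAlgebraKFbar; letI := T.instIsElliptic
    ∀ p ∈ T.I.supportPrimes, ∀ v w : placesOver (fieldOfModuli T.E) p,
      (Summit.ABC.IUTFork.DHData.ofInput T.I).logQloc p v = (Summit.ABC.IUTFork.DHData.ofInput T.I).logQloc p w := by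
  classical
  letI := T.instFieldF; letI := T.instNumberFieldF; letI := T.instAlgebraF; letI := T.instFieldK
  letI := T.instNumberFieldK; letI := T.instAlgebraK; letI := T.instFieldFbar; letI := T.instAlgebraFbar
  letI := T.instAlgebraKFbar; letI := T.instIsElliptic
  intro p hp v w
  haveI : Fact p.Prime := ⟨T.I.prime_of_mem_supportPrimes hp⟩
  -- places of `F` above `v`, `w`
  obtain ⟨x, hx⟩ := PlaceSection.exists_under_eq (F₀ := fieldOfModuli T.E) (K := T.F) v.1
  obtain ⟨y, hy⟩ := PlaceSection.exists_under_eq (F₀ := fieldOfModuli T.E) (K := T.F) w.1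
  rw [logQloc_eq_pointValue T p v x hx, logQloc_eq_pointValue T p w y hy]
  -- they lie over `p`, hence so do their places of `F_tpd`
  have hres : ∀ (z : HeightOneSpectrum (𝓞 T.F)) (u : placesOver (fieldOfModuli T.E) p),
      z.under (𝓞 (fieldOfModuli T.E)) = u.1 → finBelow P.F T.F z ∈ placesOver P.F p := by
    intro z u hz
    have hfin : finBelow (fieldOfModuli T.E) T.F z = u.1 :=
      HeightOneSpectrum.ext (by rw [← hz, HeightOneSpectrum.under_asIdeal]; rfl)
    have hzp : z ∈ placesOver T.F p := by
      rw [mem_placesOver_iff_residueChar, ← residueChar_finBelow (F := fieldOfModuli T.E), hfin]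
      exact (mem_placesOver_iff_residueChar u.1).mp u.2
    exact finBelow_mem_placesOver P.F T.F hzp
  have hxp := hres x v hx
  have hyp := hres y w hy
  by_cases hX : finBelow P.F T.F x ∈ Cor22.badPlacesAvoid P {2, l}
  · have hcard := hns p ⟨finBelow P.F T.F x, hxp, hX⟩
    have heq : finBelow P.F T.F x = finBelow P.F T.F y := Finset.card_le_one.mp hcard _ hxp _ hyp
    rw [heq]
  · by_cases hY : finBelow P.F T.F y ∈ Cor22.badPlacesAvoid P {2, l}
    · have hcard := hns p ⟨finBelow P.F T.F y, hyp, hY⟩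
      have heq : finBelow P.F T.F x = finBelow P.F T.F y := Finset.card_le_one.mp hcard _ hxp _ hyp
      rw [heq]
    · rw [if_neg hX, if_neg hY]

/-- **The registered stub / `hreg` instance at a non-split point holds with ANY conclusion**: its antecedent
`¬ slot-constant` fails at every datum (`slotConstant_of_nonsplitPoint`) — the `d_mod`-free form of abc-iut-c312-8's
`hullRegime_vacuous_of_dmod_eq_one`. [cite: Mochizuki2012, IUTchIV Thm. 1.10 Step (v) p. 27–28] -/
theorem hullRegimeAt_of_nonsplitPoint (T : Cor22.ThetaVolumeDatumAt P l)
    (hns : ∀ (p : ℕ) [Fact p.Prime], (∃ V ∈ placesOver P.F p, V ∈ Cor22.badPlacesAvoid P {2, l}) →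
      (placesOver P.F p).card ≤ 1)
    {C : Prop}
    (hnc : letI := T.instFieldF; letI := T.instNumberFieldF; letI := T.instAlgebraF; letI := T.instFieldK
      letI := T.instNumberFieldK; letI := T.instAlgebraK; letI := T.instFieldFbar; letI := T.instAlgebraFbar
      letI := T.instAlgebraKFbar; letI := T.instIsElliptic
      ¬ (∀ p ∈ T.I.supportPrimes, ∀ v w : placesOver (fieldOfModuli T.E) p,
        (Summit.ABC.IUTFork.DHData.ofInput T.I).logQloc p v = (Summit.ABC.IUTFork.DHData.ofInput T.I).logQloc p w)) :
    C :=
  absurd (slotConstant_of_nonsplitPoint T hns) hnc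

/-- **(ii′-U) IS A THEOREM ON THE NON-SPLIT LOCUS**: for `P ∈ U_P` (minimally presented `λ ∈ U_X`), `l ≥ 7`, and every
rational prime under a pole of `j(λ)` away from `2l` carrying exactly one place of `ℚ(λ)`:
`Cor22.HullVolumeAtDatum P l B_III(P,l)` — the conclusion of v3's CONE binder `hvol` at `(P, l)`, for EVERY genuine
Θ-volume datum, with NO further hypothesis (abc-iut-S3's pinned junction `hullEstimateOf_BIII_pinned` fed abc-iut-S1's
(R4) `R4_towerFact` and the slot-constancy `slotConstant_of_nonsplitPoint`). At any `d_mod`; at `d_mod = 1` it is S3's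
`hullVolumeAtDatum_BIII_pinned_of_dmod_eq_one`. Nothing asserted about print. [cite: Mochizuki2012, IUTchIV Thm. 1.10 proof Steps (ii)–(viii) p. 24–30]
[claim: Mochizuki2012, status: disputed] -/
theorem hullVolumeAtDatum_BIII_of_nonsplitPoint (hP : P ∈ UP) (h7 : 7 ≤ l)
    (hns : ∀ (p : ℕ) [Fact p.Prime], (∃ V ∈ placesOver P.F p, V ∈ Cor22.badPlacesAvoid P {2, l}) →
      (placesOver P.F p).card ≤ 1) :
    Cor22.HullVolumeAtDatum P l (((l : ℝ) + 1) / 4 * ((1 + 12 * (Cor22.dmod P : ℝ) / l)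
      * (P.logDiff + Cor22.logCondAvoid P {2, l}) + 2 * Real.log l + 52
        + 20 / 3 * Real.log (((2 ^ 12 * 3 ^ 3 * 5 * Cor22.dmod P : ℕ) : ℝ) * (l : ℝ))
          * (Nat.primeCounting (2 ^ 12 * 3 ^ 3 * 5 * Cor22.dmod P * l) : ℝ))) :=
  fun T => hullEstimateOf_BIII_pinned T hP h7 (T.R4_towerFact hP) (slotConstant_of_nonsplitPoint T hns)

end PointDict

open PointDict

/-- **v3's `hvol` / v4–v5K's `hreg` AT A NON-SPLIT POINT, under their own binders**: `P ∈ U_P`, `l ≥ 5` prime with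
`AdmitsCore`, `CondP2`, `CondP5`, `CondP6` (so `l ≥ 7`, abc-iut-S-d1/L5-t7 `Cor22.seven_le_of_condP6`), and every rational
prime under a pole of `j(λ)` away from `2l` carrying exactly one place of `ℚ(λ)`: `Cor22.HullVolumeAtDatum P l B_III(P,l)`.
So on the non-split locus (any `d_mod`) the (U)-line reduces to the Corollary stub `stub_cor312` ALONE — the mirror image
of the split-bad locus (p435674: there the Corollary stub is the theorem and `hreg` carries Thm. 1.10's display).
Nothing asserted about print; no side taken. [cite: Mochizuki2012, IUTchIV Thm. 1.10 proof Steps (ii)–(viii) p. 24–30]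
[cite: Mochizuki2012, IUTchIV Cor. 2.2 (ii) proof p. 46] [claim: Mochizuki2012, status: disputed] -/
theorem hvolAt_of_nonsplitPoint {P : NFPoint} (hP : P ∈ UP) {l : ℕ} (hl : l.Prime) (h5 : 5 ≤ l)
    (_hc : Cor22.AdmitsCore P) (_h2 : Cor22.CondP2 P l) (_h5' : Cor22.CondP5 P l) (h6 : Cor22.CondP6 P l)
    (hns : ∀ (p : ℕ) [Fact p.Prime], (∃ V ∈ placesOver P.F p, V ∈ Cor22.badPlacesAvoid P {2, l}) →
      (placesOver P.F p).card ≤ 1) :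
    Cor22.HullVolumeAtDatum P l (((l : ℝ) + 1) / 4 * ((1 + 12 * (Cor22.dmod P : ℝ) / l)
      * (P.logDiff + Cor22.logCondAvoid P {2, l}) + 2 * Real.log l + 52
        + 20 / 3 * Real.log (((2 ^ 12 * 3 ^ 3 * 5 * Cor22.dmod P : ℕ) : ℝ) * (l : ℝ))
          * (Nat.primeCounting (2 ^ 12 * 3 ^ 3 * 5 * Cor22.dmod P * l) : ℝ))) :=
  hullVolumeAtDatum_BIII_of_nonsplitPoint hP (Cor22.seven_le_of_condP6 hP.1 hl h5 h6) hns

/-- **The `hreg`-shaped instance at a non-split point** (the body of `stub_hullRegime` at `(P, l)`): for every datum `T`,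
`¬ slot-constant → T.HullEstimateOf B_III(P,l)` — here even WITHOUT using the (false) antecedent.
[cite: Mochizuki2012, IUTchIV Thm. 1.10 Step (v) p. 27–28] [claim: Mochizuki2012, status: disputed] -/
theorem hregAt_of_nonsplitPoint {P : NFPoint} (hP : P ∈ UP) {l : ℕ} (hl : l.Prime) (h5 : 5 ≤ l)
    (hc : Cor22.AdmitsCore P) (h2 : Cor22.CondP2 P l) (h5' : Cor22.CondP5 P l) (h6 : Cor22.CondP6 P l)
    (hns : ∀ (p : ℕ) [Fact p.Prime], (∃ V ∈ placesOver P.F p, V ∈ Cor22.badPlacesAvoid P {2, l}) →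
      (placesOver P.F p).card ≤ 1)
    (T : Cor22.ThetaVolumeDatumAt P l) :
    (letI := T.instFieldF; letI := T.instNumberFieldF; letI := T.instAlgebraF; letI := T.instFieldK
     letI := T.instNumberFieldK; letI := T.instAlgebraK; letI := T.instFieldFbar; letI := T.instAlgebraFbar
     letI := T.instAlgebraKFbar; letI := T.instIsElliptic
     ¬ (∀ p ∈ T.I.supportPrimes, ∀ v w : placesOver (fieldOfModuli T.E) p,
        (Summit.ABC.IUTFork.DHData.ofInput T.I).logQloc p v = (Summit.ABC.IUTFork.DHData.ofInput T.I).logQloc p w)) →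
    T.HullEstimateOf
      (((l : ℝ) + 1) / 4 *
        ((1 + 12 * (Cor22.dmod P : ℝ) / l) * (P.logDiff + Cor22.logCondAvoid P {2, l})
          + 2 * Real.log l + 52
          + 20 / 3 * Real.log (((2 ^ 12 * 3 ^ 3 * 5 * Cor22.dmod P : ℕ) : ℝ) * (l : ℝ))
            * (Nat.primeCounting (2 ^ 12 * 3 ^ 3 * 5 * Cor22.dmod P * l) : ℝ))) :=
  fun _ => hvolAt_of_nonsplitPoint hP hl h5 hc h2 h5' h6 hns T

end Summit.ABC.IUTFork

end
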